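import Summits.CriticalPhenomena.PercolationContinuityZ3.Theorems.PercNearOneGluingAdditiveGluingFingerSetForm
import Summits.CriticalPhenomena.PercolationContinuityZ3.Theorems.PercNearOneGluingNoHeavyLowerTailMLnaCexChecker
import Literature.Probability.LatticeModels.ProdBernoulliIndependence
import HarnessLib

/-! # Crux `PercNearOneGluing.AdditiveGluing` (stmt-CriticalPhenomena-4576) — the SINGLE-DESIGNATION sharpening (G₁) of the
# finger multi-edge Lemma 3 `stub_fingerML3_vp` is FALSE: a certified weighted counterexample on six vertices

Support file (`--supports stmt-CriticalPhenomena-4576`, seat (b) V⁺-form, depth prover `png-dp-vplus`, gen 6); no definitions of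
mathematical content (the `def`s are witness data and computable checkers), no named facts, no sorries, standard axioms
(the arithmetic is kernel `decide`, not `native_decide`).

The registered open stub `stub_fingerML3_vp` (conjecture "G"; 0 violations in 4.1·10⁹ exact hypothesis-satisfying instances of
the ttrl census `run/shared/lean/ttrl/setG/README.md`) reads: for a weighting `K` on `Fin n`, relays `A ∋ b, d`, a nonempty block `N`
disjoint from `A` all of whose positive pairs go to `A ∪ N`, IF `μ_K(d↔b) ≤ μ_K(a↔b)` for EVERY `a ∈ A`, THEN
`μ_{K/N}(R ∩ {d↔b}) ≤ μ_{K/N}(R ∩ ⋃_{v∈N}{v↔b})` (`K/N` = the pairs inside `N` set to weight `1`, `R` = some pair `N–A` open).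
Its proposed sharpening (G₁) (memo MEMO-gen4 §6 of this seat, the "single-designation form": Kozma–Nitzan's proof of their
Theorem 4 compares `d` with ONE relay only, the minimiser `a₀` of the base two-point function `μ_q(·↔b)`, `q = K` with the pairs at `N`
removed) keeps the conclusion and weakens the hypothesis to
  `a₀ ∈ A` minimises `μ_q(·↔b)` over `A ∖ {d}`  and  `μ_K(d↔b) ≤ μ_K(a₀↔b)`  (one unglued comparison).

**THIS FILE SHOWS THAT (G₁) FAILS ON SIX VERTICES** (witness of the ttrl engine census, request `set-thm4-G`, clean rational form;
re-verified here by KERNEL REDUCTION):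

* vertices `Fin 6`: `b = 0`, `d = 1`, block `N = {2, 3}`, relays `A = {0, 1, 4, 5}` (so `A ∪ N` is everything and the
  "positive pairs at `N` go to `A ∪ N`" condition is vacuous);
* weights `K(0,1) = 5/8`, `K(0,2) = 3/8`, `K(0,4) = 1/2`, `K(1,5) = 7/8`, `K(2,4) = 3/4`, `K(3,5) = 1`, all other pairs `0`;
* base (`N`-pairs removed): `μ_q(4↔b) = 1/2 ≤ μ_q(5↔b) = 35/64 ≤ μ_q(0↔b) = 1`, so `a₀ = 4` (and `μ_q(d↔b) = 5/8 > 1/2`: `d` is NOT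
  base-minimal, the instance is non-trivial);  the single comparison holds: `μ_K(d↔b) = 40/64 ≤ μ_K(4↔b) = 41/64`;
* but the conclusion fails: in unglued set form (`fingerML3_iff_setForm`) it would say
  `μ_K(R ∩ {d↮N} ∩ {d↔b}) ≤ μ_K(R ∩ {d↮N} ∩ ⋃_{v∈N}{v↔b})`, and here (`R` holds a.s. because `K(3,5) = 1`)
  `μ_K({d↮N} ∩ {d↔b}) = 125/4096 > 117/4096 = μ_K({d↮N} ∩ {N↔b})` — margin `−8/4096 = −1/512`.

The full hypothesis of the stub FAILS here (`μ_K(5↔b) = 35/64 < μ_K(d↔b)`): the contact `5` "rides on `d`" (its only route to `b`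
passes through `d`) and the finger `3` hangs off it with weight `1`; the single hypothesis at `a₀ = 4` does not see it.  So a proof of
`stub_fingerML3_vp` must use the hypothesis at relays other than the base-argmin — at least at relays whose routes to `b` pass
through `d` (ttrl: all 129 + 251 exact (G₁)-violations found have this anatomy; conjecture G itself has none).  Conjecture G, DI-R and
DI-K⁺ are NOT touched by this witness.

Contents: witness data (`witG1`, base list `witG1q`), the identification of the base weighting with `wOfList witG1q`
(`baseWeight_eq`), the two events of the set form as `Bool` tests / exact counts (`dFarB/cntDFar`, `nFarB/cntNFar`, `real_dFar`,
`real_nFar`), `R` almost sure (`real_inter_R`), the kernel-checked arithmetic (`facts`), and the deliverables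
`fingerML3_singleDesignation_cex` (the six-vertex instance: hypotheses of (G₁) hold, conclusion of the stub fails) and
`not_fingerML3_singleDesignation` (¬(G₁), (G₁) written verbatim as in MEMO-gen4 §6 with the stub's conclusion).
[cite: KozmaNitzan2024, Thm 4 and Lemma 5 (§3.2, pp. 12–14)]
-/

namespace Summit.CriticalPhenomena.PercolationContinuityZ3.Theorems

open MeasureTheory Set
open Literature.Probability.LatticeModels Literature.Probability.Percolation
open Summit.CriticalPhenomena.PercolationContinuityZ3.Theorems.AdditiveGluing.Negative.Cert
open Summit.CriticalPhenomena.PercolationContinuityZ3.Theorems.WorstPairExchangeCex (real_eq_wcount)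

noncomputable section
open Classical

namespace FingerSingleDesignationCex

/-! ### The witness -/

/-- The witness weights on `Fin 6` (`b = 0`, `d = 1`, `N = {2,3}`, contacts `4, 5`):
`K(0,1) = 5/8, K(0,2) = 3/8, K(0,4) = 1/2, K(1,5) = 7/8, K(2,4) = 3/4, K(3,5) = 1`. -/
def witG1 : List (Fin 6 × Fin 6 × ℚ) :=
  [(0, 1, 5/8), (0, 2, 3/8), (0, 4, 1/2), (1, 5, 7/8), (2, 4, 3/4), (3, 5, 1)]

/-- The base weights (`witG1` with the pairs at `N = {2,3}` removed). -/
def witG1q : List (Fin 6 × Fin 6 × ℚ) :=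
  [(0, 1, 5/8), (0, 4, 1/2), (1, 5, 7/8)]

/-- The listed pairs of the witness are distinct. [this file] -/
theorem witG1_nodup : (wPairs witG1).Nodup := by decide

/-- The witness weights lie in `[0, 1]`. [this file] -/
theorem witG1_weights : ∀ e ∈ witG1, 0 ≤ e.2.2 ∧ e.2.2 ≤ 1 := by
  intro e he
  simp only [witG1, List.mem_cons, List.not_mem_nil, or_false] at he
  rcases he with rfl | rfl | rfl | rfl | rfl | rfl <;> norm_num

/-- The listed pairs of the base list are distinct. [this file] -/
theorem witG1q_nodup : (wPairs witG1q).Nodup := by decide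

/-- The base weights lie in `[0, 1]`. [this file] -/
theorem witG1q_weights : ∀ e ∈ witG1q, 0 ≤ e.2.2 ∧ e.2.2 ≤ 1 := by
  intro e he
  simp only [witG1q, List.mem_cons, List.not_mem_nil, or_false] at he
  rcases he with rfl | rfl | rfl <;> norm_num

/-- **The base weighting is `wOfList witG1q`.**  Removing the pairs at `N = {2,3}` from the witness weights gives the
base list. [this file] -/
theorem baseWeight_eq :
    (fun e : Sym2 (Fin 6) => if (∃ y ∈ e, y ∈ ({2, 3} : Finset (Fin 6))) then (0 : unitInterval) else wOfList witG1 e) =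
      wOfList witG1q := by
  funext x
  induction x using Sym2.ind with
  | _ i j =>
    fin_cases i <;> fin_cases j <;> simp [wOfList, witG1, witG1q, mkE]

/-- The pair `35` of the witness has weight `1`. [this file] -/
theorem witG1_35 : (wOfList witG1 s(3, 5) : ℝ) = 1 := by
  have h : wOfList witG1 s(3, 5) = Set.projIcc (0 : ℝ) 1 zero_le_one ((1 : ℚ) : ℝ) := by
    simp [wOfList, witG1, mkE]
  rw [h]
  simp [Set.projIcc]

/-! ### The two events of the unglued set form as `Bool` tests and exact counts -/

/-- `d ↔ b` and `d` is joined to no vertex of `N` (`d = 1`, `b = 0`, `N = {2,3}`). -/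
def dFarB (tb : List ℕ) : Bool :=
  decide ((tb.getD ((1 : Fin 6) : ℕ) 0).testBit ((0 : Fin 6) : ℕ) = true ∧
    ∀ x ∈ ({2, 3} : Finset (Fin 6)), (tb.getD ((1 : Fin 6) : ℕ) 0).testBit (x : ℕ) = false)

/-- some vertex of `N` is joined to `b` and `d` is joined to no vertex of `N`. -/
def nFarB (tb : List ℕ) : Bool :=
  decide ((∃ v ∈ ({2, 3} : Finset (Fin 6)), (tb.getD (v : ℕ) 0).testBit ((0 : Fin 6) : ℕ) = true) ∧
    ∀ x ∈ ({2, 3} : Finset (Fin 6)), (tb.getD ((1 : Fin 6) : ℕ) 0).testBit (x : ℕ) = false)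

/-- Exact count of `{d↮N} ∩ {d↔b}`. -/
def cntDFar (l : List (Fin 6 × Fin 6 × ℚ)) : ℚ :=
  ((wtabs 6 l).map fun t => if dFarB t.1 then t.2 else 0).sum

/-- Exact count of `{d↮N} ∩ {N↔b}`. -/
def cntNFar (l : List (Fin 6 × Fin 6 × ℚ)) : ℚ :=
  ((wtabs 6 l).map fun t => if nFarB t.1 then t.2 else 0).sum

/-- `μ_K({d↮N} ∩ {d↔b}) = cntDFar`. [this file] -/
theorem real_dFar {l : List (Fin 6 × Fin 6 × ℚ)} (hnd : (wPairs l).Nodup) (hq : ∀ e ∈ l, 0 ≤ e.2.2 ∧ e.2.2 ≤ 1) :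
    (prodBernoulli (wOfList l)).real
        ({ω : BondConfig (Fin 6) | ∀ x ∈ (↑({2, 3} : Finset (Fin 6)) : Set (Fin 6)), ¬ (openGraph ω).Reachable 1 x} ∩
          openConn 1 0) = (cntDFar l : ℝ) := by
  refine real_eq_wcount hnd hq dFarB _ fun ω => ?_
  simp only [dFarB, decide_eq_true_eq, Set.mem_inter_iff, Set.mem_setOf_eq, Finset.mem_coe, Bool.eq_false_iff, ne_eq,
    testBit_reachTable_iff_mem_openConn, openConn]
  tauto

/-- `μ_K({d↮N} ∩ ⋃_{v∈N}{v↔b}) = cntNFar`. [this file] -/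
theorem real_nFar {l : List (Fin 6 × Fin 6 × ℚ)} (hnd : (wPairs l).Nodup) (hq : ∀ e ∈ l, 0 ≤ e.2.2 ∧ e.2.2 ≤ 1) :
    (prodBernoulli (wOfList l)).real
        ({ω : BondConfig (Fin 6) | ∀ x ∈ (↑({2, 3} : Finset (Fin 6)) : Set (Fin 6)), ¬ (openGraph ω).Reachable 1 x} ∩
          ⋃ v ∈ ({2, 3} : Finset (Fin 6)), openConn v 0) = (cntNFar l : ℝ) := by
  refine real_eq_wcount hnd hq nFarB _ fun ω => ?_
  simp only [nFarB, decide_eq_true_eq, Set.mem_inter_iff, Set.mem_setOf_eq, Finset.mem_coe, Bool.eq_false_iff, ne_eq,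
    testBit_reachTable_iff_mem_openConn, openConn, Set.mem_iUnion, exists_prop]
  tauto

/-! ### The arithmetic (exact rational counts over `2⁶` resp. `2³` configurations, kernel `decide`) -/

/-- The facts: base order `μ_q(4↔b) ≤ μ_q(0↔b)`, `μ_q(4↔b) ≤ μ_q(5↔b)`, `μ_q(4↔b) < μ_q(d↔b)` (non-trivial instance);
the single unglued comparison `μ_K(d↔b) ≤ μ_K(4↔b)`; the full hypothesis fails at `5` (`μ_K(5↔b) < μ_K(d↔b)`); and the violated
conclusion `cntNFar < cntDFar` (`117/4096 < 125/4096`). [this file] -/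
theorem facts : wConn (wtabs 6 witG1q) 4 0 ≤ wConn (wtabs 6 witG1q) 0 0 ∧ wConn (wtabs 6 witG1q) 4 0 ≤ wConn (wtabs 6 witG1q) 5 0 ∧
    wConn (wtabs 6 witG1q) 4 0 < wConn (wtabs 6 witG1q) 1 0 ∧
    wConn (wtabs 6 witG1) 1 0 ≤ wConn (wtabs 6 witG1) 4 0 ∧ wConn (wtabs 6 witG1) 5 0 < wConn (wtabs 6 witG1) 1 0 ∧
    cntNFar witG1 < cntDFar witG1 := by
  decide +kernel

/-! ### `R` is almost sure at the witness -/

/-- At the witness the event `R` (some pair `N–A` open) is almost sure, because the pair `35` (`3 ∈ N`, `5 ∈ A`) has weight `1`: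
`μ_K(R ∩ D) = μ_K(D)` for every event `D`. [this file] -/
theorem real_inter_R (D : Set (BondConfig (Fin 6))) :
    (prodBernoulli (wOfList witG1)).real
        ({ω : Set (Sym2 (Fin 6)) | ∃ v ∈ ({2, 3} : Finset (Fin 6)), ∃ a ∈ ({0, 1, 4, 5} : Finset (Fin 6)), s(v, a) ∈ ω} ∩ D) =
      (prodBernoulli (wOfList witG1)).real D := by
  set μ := prodBernoulli (wOfList witG1) with hμ
  set R : Set (BondConfig (Fin 6)) :=
    {ω : Set (Sym2 (Fin 6)) | ∃ v ∈ ({2, 3} : Finset (Fin 6)), ∃ a ∈ ({0, 1, 4, 5} : Finset (Fin 6)), s(v, a) ∈ ω} with hR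
  have hRc : μ.real Rᶜ = 0 := by
    have hsub : Rᶜ ⊆ {ω : Set (Sym2 (Fin 6)) | s(3, 5) ∉ ω} := by
      intro ω hω h35
      exact hω ⟨3, by decide, 5, by decide, h35⟩
    have h0 : μ.real {ω : Set (Sym2 (Fin 6)) | s(3, 5) ∉ ω} = 0 := by
      rw [hμ, prodBernoulli_real_setOf_notMem, witG1_35]; norm_num
    exact le_antisymm ((measureReal_mono hsub (measure_ne_top _ _)).trans (le_of_eq h0)) measureReal_nonneg
  have hsplit := measureReal_inter_add_sdiff (μ := μ) (s := D) (MeasurableSet.of_discrete : MeasurableSet R)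
    (measure_ne_top _ _)
  have hdiff : μ.real (D \ R) = 0 :=
    le_antisymm ((measureReal_mono (fun ω hω => hω.2) (measure_ne_top _ _)).trans (le_of_eq hRc)) measureReal_nonneg
  rw [Set.inter_comm]
  linarith

end FingerSingleDesignationCex

open FingerSingleDesignationCex

/-- **The six-vertex instance.**  At the witness weights `K = wOfList witG1` with `A = {0,1,4,5}`, `N = {2,3}`, `d = 1`, `b = 0`,
`a₀ = 4`: the hypotheses of the single-designation form (G₁) hold — `a₀` minimises the base two-point function over `A ∖ {d}`
and `μ_K(d↔b) ≤ μ_K(a₀↔b)` — while the conclusion of `stub_fingerML3_vp` FAILS (in its unglued set form, `fingerML3_iff_setForm`).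
[this file] -/
theorem fingerML3_singleDesignation_cex :
    (∀ a ∈ ({0, 1, 4, 5} : Finset (Fin 6)), a ≠ (1 : Fin 6) →
      (prodBernoulli (fun e : Sym2 (Fin 6) => if (∃ y ∈ e, y ∈ ({2, 3} : Finset (Fin 6))) then 0 else wOfList witG1 e)).real
          (openConn (4 : Fin 6) 0) ≤
        (prodBernoulli (fun e : Sym2 (Fin 6) => if (∃ y ∈ e, y ∈ ({2, 3} : Finset (Fin 6))) then 0 else wOfList witG1 e)).real
          (openConn a 0)) ∧
    (prodBernoulli (wOfList witG1)).real (openConn (1 : Fin 6) 0) ≤ (prodBernoulli (wOfList witG1)).real (openConn (4 : Fin 6) 0) ∧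
    ¬ ((prodBernoulli (fun e' : Sym2 (Fin 6) => if (∀ y ∈ e', y ∈ ({2, 3} : Finset (Fin 6))) ∧ ¬ e'.IsDiag then 1 else wOfList witG1 e')).real
          ({ω : Set (Sym2 (Fin 6)) | ∃ v ∈ ({2, 3} : Finset (Fin 6)), ∃ a ∈ ({0, 1, 4, 5} : Finset (Fin 6)), s(v, a) ∈ ω} ∩
            openConn (1 : Fin 6) 0) ≤
        (prodBernoulli (fun e' : Sym2 (Fin 6) => if (∀ y ∈ e', y ∈ ({2, 3} : Finset (Fin 6))) ∧ ¬ e'.IsDiag then 1 else wOfList witG1 e')).real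
          ({ω : Set (Sym2 (Fin 6)) | ∃ v ∈ ({2, 3} : Finset (Fin 6)), ∃ a ∈ ({0, 1, 4, 5} : Finset (Fin 6)), s(v, a) ∈ ω} ∩
            ⋃ v ∈ ({2, 3} : Finset (Fin 6)), openConn v 0)) := by
  obtain ⟨hq0, hq5, -, hK, -, hviol⟩ := facts
  refine ⟨?_, ?_, ?_⟩
  · intro a ha had
    rw [baseWeight_eq, real_openConn_eq_wConn witG1q_nodup witG1q_weights, real_openConn_eq_wConn witG1q_nodup witG1q_weights]
    simp only [Finset.mem_insert, Finset.mem_singleton] at ha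
    rcases ha with rfl | rfl | rfl | rfl
    · exact_mod_cast hq0
    · exact absurd rfl had
    · exact le_rfl
    · exact_mod_cast hq5
  · rw [real_openConn_eq_wConn witG1_nodup witG1_weights, real_openConn_eq_wConn witG1_nodup witG1_weights]
    exact_mod_cast hK
  · intro hle
    have hNA : Disjoint ({2, 3} : Finset (Fin 6)) ({0, 1, 4, 5} : Finset (Fin 6)) := by decide
    have hset := (fingerML3_iff_setForm (wOfList witG1) {0, 1, 4, 5} {2, 3} 1 0 hNA).1 hle
    rw [Set.inter_assoc, Set.inter_assoc, real_inter_R, real_inter_R, real_dFar witG1_nodup witG1_weights,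
      real_nFar witG1_nodup witG1_weights] at hset
    have h' : cntDFar witG1 ≤ cntNFar witG1 := by exact_mod_cast hset
    exact absurd h' (not_le.2 hviol)

/-- **The single-designation form (G₁) of `stub_fingerML3_vp` is FALSE.**  The negated statement is (G₁) of memo MEMO-gen4 §6
(this seat, 2026-08-19): the registered stub with its hypothesis `∀ a ∈ A, μ_K(d↔b) ≤ μ_K(a↔b)` replaced by the single comparison
with a base-minimiser `a₀` of `A ∖ {d}` (base weighting `q` = `K` with the pairs meeting `N` set to `0`).  It fails on `Fin 6`
(`fingerML3_singleDesignation_cex`).  The registered stub (conjecture G) is not refuted: at the witness its hypothesis fails at the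
relay `5`. [this file] -/
theorem not_fingerML3_singleDesignation :
    ¬ (∀ (n : ℕ) (K : Sym2 (Fin n) → unitInterval) (A N : Finset (Fin n)) (d b a₀ : Fin n),
      b ∈ A → Disjoint N A → N.Nonempty → d ∈ A → a₀ ∈ A →
      (∀ v ∈ N, ∀ y : Fin n, y ∉ A → y ∉ N → (K s(v, y) : ℝ) = 0) →
      (∀ a ∈ A, a ≠ d →
        (prodBernoulli (fun e : Sym2 (Fin n) => if (∃ y ∈ e, y ∈ N) then 0 else K e)).real (openConn a₀ b) ≤
          (prodBernoulli (fun e : Sym2 (Fin n) => if (∃ y ∈ e, y ∈ N) then 0 else K e)).real (openConn a b)) →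
      (prodBernoulli K).real (openConn d b) ≤ (prodBernoulli K).real (openConn a₀ b) →
      (prodBernoulli (fun e' : Sym2 (Fin n) => if (∀ y ∈ e', y ∈ N) ∧ ¬ e'.IsDiag then 1 else K e')).real
          ({ω : Set (Sym2 (Fin n)) | ∃ v ∈ N, ∃ a ∈ A, s(v, a) ∈ ω} ∩ openConn d b) ≤
        (prodBernoulli (fun e' : Sym2 (Fin n) => if (∀ y ∈ e', y ∈ N) ∧ ¬ e'.IsDiag then 1 else K e')).real
          ({ω : Set (Sym2 (Fin n)) | ∃ v ∈ N, ∃ a ∈ A, s(v, a) ∈ ω} ∩ ⋃ v ∈ N, openConn v b)) := by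
  intro h
  obtain ⟨hbase, hK, hnot⟩ := fingerML3_singleDesignation_cex
  refine hnot (h 6 (wOfList witG1) {0, 1, 4, 5} {2, 3} 1 0 4 (by decide) (by decide) (by decide) (by decide) (by decide)
    ?_ hbase hK)
  intro v _ y hyA hyN
  exfalso
  revert y
  decide

end

end Summit.CriticalPhenomena.PercolationContinuityZ3.Theorems
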